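/-
COR-CM (cell pub-hodgecm2, stage 2 of the Hodge ladder) — count-neutral KERNEL COMBINATORICS «the index-two cyclic law» (modular ∪ semidihedral
columns), part VIII: THE BLOCK COUNT at 2-power level (seat prover-pub-hodgecm2-b23-g49-0, binder prover b23, gen 49; claim «INDEX-TWO CYCLIC LAW»,
HOME/INBOX.md l.22678).  Theorems only, on part I (`Census/IndexTwoCyclicDatum.lean`) and seat b09ʼs Burnside block count
(`BlockParity.card_block_mul_card`: `Census/BlockParityBurnside.lean`) BY NAME; no `decide` beyond closed numerals in `ZMod 8` / `ZMod 16`, no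
certificate, no named fact, no `sorry`; `Interfaces.lean` (C1), every E term, B01, `Transposition/*`, `PortJoin/*`, `D2Bridge/*` untouched.
HONEST FRAMING: `HC_CM` is NOT proved, here or anywhere in the tree; nothing here is a period, a count of record or a headline.
T5: n/a-class (hypothesis binders = the fields of `IndexTwoCyclic.Datum`, `c·c = 1`, `c ≠ 1`, `n = 2ᵃ`; checker: self).
-/
import Summits.HodgeConjecture.CorCM.Census.IndexTwoCyclicDatum
import Summits.HodgeConjecture.CorCM.Census.BlockParityBurnside

/-!
# The index-two cyclic law, VIII: the block count `β · 4n = 4ⁿ + N · 2ⁿ` at 2-power level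

For an index-two cyclic datum `(G ⊃ ⟨u⟩ ∋ c = uⁿ, w)` of 2-power level `n = 2ᵃ` (`G ≅ ℤ/2n ⋊_r ℤ/2` a 2-group of order `4n`), Burnside
(`BlockParity.card_block_mul_card`: `β·|G| = Σ_{g : c ∉ ⟨g⟩} 2^{|G|/(2·ord g)}`) has exactly two kinds of terms: `g = 1` (every other rotation
`uᵏ` has `c` among its powers, `c_mem_zpowers_pow`) and the INVOLUTIONS of the coset `⟨u⟩·w` (a coset element with `g² ≠ 1` has `c ∈ ⟨g²⟩ ⊆ ⟨g⟩`):

* §1 **`card_block_mul_four_mul`**: `β · 4n = 4ⁿ + #{g ∉ ⟨u⟩ ∣ g·g = 1} · 2ⁿ`, and the involutions of the coset are the `uⁱ·w` with `(r+1)·i = 0`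
  in `ℤ/2n` (`card_coset_involutions`): **`β · 4n = 4ⁿ + #{z ∈ ℤ/2n ∣ (r+1)·z = 0} · 2ⁿ`** (`card_block_mul_four_mul_eq`).
* §2 ROWS: semidihedral type at level `4` (`(r+1) ≡ 4 (mod 8)`, `SD₁₆`): **`β = 20`**; modular type at level `4` (`(r+1) ≡ 6`, `M₁₆`): **`β = 18`**;
  level `8`: `SD₃₂` (`(r+1) ≡ 8 (mod 16)`) **`β = 2112`**, `M₃₂` (`(r+1) ≡ 10`) **`β = 2064`** — so, with part VI, `μ(SD₁₆) = 19`, `μ(M₁₆) = 17`,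
  `μ(SD₃₂) = 2111`, `μ(M₃₂) = 2063`.

## References
* [Pohlmann1968] H. Pohlmann, Algebraic cycles on abelian varieties of complex multiplication type, Ann. of Math. 88 (1968), Thm 1.
* [Milne1999] J. S. Milne, Lefschetz motives and the Tate conjecture, Compositio Math. 117 (1999), Prop. 2.1, p. 54.
-/

namespace Summit.HodgeConjecture.CorCM.Census.IndexTwoCyclic

open Finset
open Summit.HodgeConjecture.CorCM.Prior.AllgGroup.RfwfAllgGroup
open Summit.HodgeConjecture.CorCM.Census.BlockParity

noncomputable section

variable {G : Type*} [Group G] [Fintype G] [DecidableEq G] {c : G} {n : ℕ} [NeZero n]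
variable (D : Datum G c n)

/-! ## §1 The block count at 2-power level -/

omit [DecidableEq G] [NeZero n] in
include D in
/-- `|G| = 4n` along the datum. [folklore] -/
private theorem card_G : Fintype.card G = 4 * n := by
  have h := (Subgroup.zpowers D.u).card_mul_index
  rw [Nat.card_zpowers, D.hord, D.hindex, Nat.card_eq_fintype_card] at h
  omega

omit [Fintype G] [DecidableEq G] [NeZero n] in
/-- **For `n = 2ᵃ`, `c` is a power of every non-trivial rotation `uᵏ`** (`0 < k < 2n`): writing `k = 2ᵛ·m` with `m` odd, `v ≤ a` and
`(uᵏ)^{2^{a−v}} = u^{m·n} = cᵐ = c`. [folklore] -/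
theorem c_mem_zpowers_pow (hc2 : c * c = 1) {a : ℕ} (ha : n = 2 ^ a) {k : ℕ} (hk0 : k ≠ 0) (hk : k < 2 * n) :
    c ∈ Subgroup.zpowers (D.u ^ k) := by
  obtain ⟨v, m, hm, rfl⟩ := Nat.exists_eq_two_pow_mul_odd hk0
  have hm1 : 1 ≤ m := hm.pos
  have hva : v ≤ a := by
    have h1 : 2 ^ v < 2 ^ (a + 1) := by
      calc 2 ^ v ≤ 2 ^ v * m := Nat.le_mul_of_pos_right _ hm1
        _ < 2 * n := hk
        _ = 2 ^ (a + 1) := by rw [ha, pow_succ, mul_comm]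
    exact Nat.le_of_lt_succ ((Nat.pow_lt_pow_iff_right (by norm_num)).mp h1)
  refine Subgroup.mem_zpowers_iff.mpr ⟨(2 ^ (a - v) : ℕ), ?_⟩
  rw [zpow_natCast, ← pow_mul]
  have e : 2 ^ v * m * 2 ^ (a - v) = n * m := by
    rw [ha, mul_comm (2 ^ v) m, mul_assoc, ← pow_add, Nat.add_sub_cancel' hva, mul_comm]
  rw [e, pow_mul, D.hun]
  obtain ⟨j, rfl⟩ := hm
  rw [pow_succ, pow_mul, pow_two, hc2, one_pow, one_mul]

omit [Fintype G] [DecidableEq G] [NeZero n] in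
/-- The square of `u^k·w` is the rotation `u^{(r+1)k}`. [folklore] -/
theorem pow_mul_w_mul_self (k : ℕ) : D.u ^ k * D.w * (D.u ^ k * D.w) = D.u ^ ((D.r + 1) * k) := by
  rw [mul_assoc, ← mul_assoc D.w, D.w_mul_pow, mul_assoc, D.hww, mul_one, ← pow_add, add_mul, one_mul, add_comm]

omit [Fintype G] [DecidableEq G] [NeZero n] in
/-- **A coset involution does not carry `c`**: if `g ∉ ⟨u⟩` and `g·g = 1` then `c ∉ ⟨g⟩` (`⟨g⟩ = {1, g}`, `c ∈ ⟨u⟩ ∖ {1}`). [folklore] -/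
theorem c_notMem_zpowers_of_involution (hc1 : c ≠ 1) {g : G} (hg : g ∉ Subgroup.zpowers D.u) (hgg : g * g = 1) :
    c ∉ Subgroup.zpowers g := by
  intro h
  obtain ⟨k, hk⟩ := Subgroup.mem_zpowers_iff.mp h
  have hord : orderOf g ∣ 2 := orderOf_dvd_of_pow_eq_one (by rw [pow_two, hgg])
  -- `g ^ k ∈ {1, g}`
  have hcases : g ^ k = 1 ∨ g ^ k = g := by
    rcases Int.emod_two_eq_zero_or_one k with h0 | h1
    · left
      rw [← zpow_mod_orderOf]
      rcases (Nat.dvd_prime Nat.prime_two).mp hord with h2 | h2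
      · rw [h2, Int.natCast_one, Int.emod_one, zpow_zero]
      · rw [h2, Nat.cast_ofNat, h0, zpow_zero]
    · right
      rw [← zpow_mod_orderOf]
      rcases (Nat.dvd_prime Nat.prime_two).mp hord with h2 | h2
      · rw [orderOf_eq_one_iff] at h2
        rw [h2, one_zpow]
      · rw [h2, Nat.cast_ofNat, h1, zpow_one]
  rcases hcases with h1 | h1
  · exact hc1 (hk.symm.trans h1)
  · have hcu : c ∈ Subgroup.zpowers D.u := by
      have h := Subgroup.pow_mem (Subgroup.zpowers D.u) (Subgroup.mem_zpowers D.u) n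
      rwa [D.hun] at h
    exact hg (by rw [← h1, hk]; exact hcu)

omit [DecidableEq G] in
/-- **A coset element with `g·g ≠ 1` carries `c`** at 2-power level: `g·g` is a non-trivial rotation. [folklore] -/
theorem c_mem_zpowers_of_not_involution (hc2 : c * c = 1) {a : ℕ} (ha : n = 2 ^ a) {g : G} (hg : g ∉ Subgroup.zpowers D.u)
    (hgg : g * g ≠ 1) : c ∈ Subgroup.zpowers g := by
  obtain ⟨i, -, rfl | rfl⟩ := D.exists_pow_or_pow_mul_w g
  · exact absurd (Subgroup.pow_mem _ (Subgroup.mem_zpowers _) i) hg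
  · rw [pow_mul_w_mul_self] at hgg
    have hn : 1 ≤ n := Nat.one_le_iff_ne_zero.mpr (NeZero.ne n)
    -- reduce the exponent mod `2n`
    set k := ((D.r + 1) * i) % (2 * n) with hkdef
    have hk : D.u ^ ((D.r + 1) * i) = D.u ^ k := by rw [hkdef, ← D.hord, pow_mod_orderOf]
    have hk0 : k ≠ 0 := fun h0 => hgg (by rw [hk, h0, pow_zero])
    have hklt : k < 2 * n := Nat.mod_lt _ (by omega)
    have h := c_mem_zpowers_pow D hc2 ha hk0 hklt
    rw [← hk, ← pow_mul_w_mul_self] at h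
    obtain ⟨m, hm⟩ := Subgroup.mem_zpowers_iff.mp h
    exact Subgroup.mem_zpowers_iff.mpr ⟨2 * m, by rw [zpow_mul, zpow_ofNat, pow_two]; exact hm⟩

include D in
/-- **THE BLOCK COUNT at 2-power level**: `β · 4n = 4ⁿ + #{g ∉ ⟨u⟩ ∣ g·g = 1} · 2ⁿ`. [folklore] -/
theorem card_block_mul_four_mul (hc2 : c * c = 1) (hc1 : c ≠ 1) {a : ℕ} (ha : n = 2 ^ a) :
    Fintype.card (Block c) * (4 * n) =
      4 ^ n + (univ.filter fun g : G => g ∉ Subgroup.zpowers D.u ∧ g * g = 1).card * 2 ^ n := by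
  classical
  have hn : 1 ≤ n := Nat.one_le_iff_ne_zero.mpr (NeZero.ne n)
  have hcen : ∀ x : G, x * c = c * x := fun x => by have h := D.comm_pow_n x; rwa [D.hun] at h
  have h := card_block_mul_card c hc2 hcen
  rw [card_G D] at h
  rw [h]
  -- evaluate the Burnside term at each `g`
  have hterm : ∀ g : G, (if c ∈ Subgroup.zpowers g then 0 else 2 ^ (4 * n / orderOf g / 2)) =
      (if g = 1 then 4 ^ n else 0) + (if g ∉ Subgroup.zpowers D.u ∧ g * g = 1 then 2 ^ n else 0) := by
    intro g
    by_cases hg1 : g = 1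
    · subst hg1
      rw [if_neg (by rw [Subgroup.zpowers_one_eq_bot, Subgroup.mem_bot]; exact hc1), if_pos rfl,
        if_neg (fun h => h.1 (Subgroup.one_mem _)), add_zero, orderOf_one, Nat.div_one, show 4 * n / 2 = 2 * n by omega, pow_mul]
      norm_num
    rw [if_neg hg1, zero_add]
    by_cases hgu : g ∈ Subgroup.zpowers D.u
    · -- a non-trivial rotation carries `c`
      obtain ⟨i, hi, rfl | rfl⟩ := D.exists_pow_or_pow_mul_w g
      · have hi0 : i ≠ 0 := fun h0 => hg1 (by rw [h0, pow_zero])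
        rw [if_pos (c_mem_zpowers_pow D hc2 ha hi0 hi), if_neg (fun h => h.1 hgu)]
      · exact absurd hgu (D.pow_mul_w_notMem i)
    · by_cases hgg : g * g = 1
      · have hord : orderOf g = 2 := orderOf_eq_prime (by rw [pow_two, hgg]) hg1
        rw [if_neg (c_notMem_zpowers_of_involution D hc1 hgu hgg), if_pos ⟨hgu, hgg⟩, hord,
          show 4 * n / 2 / 2 = n by omega]
      · rw [if_pos (c_mem_zpowers_of_not_involution D hc2 ha hgu hgg), if_neg (fun h => hgg h.2)]
  rw [Finset.sum_congr rfl (fun g _ => hterm g), Finset.sum_add_distrib, Finset.sum_ite_eq' univ (1 : G), if_pos (mem_univ _),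
    ← Finset.sum_filter, Finset.sum_const, smul_eq_mul]

/-- **The coset involutions are the `uⁱ·w` with `(r+1)·i = 0` in `ℤ/2n`**: their number is `#{z ∈ ℤ/2n ∣ (r+1)·z = 0}`. [folklore] -/
theorem card_coset_involutions :
    (univ.filter fun g : G => g ∉ Subgroup.zpowers D.u ∧ g * g = 1).card =
      (univ.filter fun z : ZMod (2 * n) => (((D.r + 1 : ℕ) : ZMod (2 * n)) * z = 0)).card := by
  classical
  symm
  refine Finset.card_bij (fun z _ => D.u ^ z.val * D.w) (fun z hz => ?_) (fun z₁ _ z₂ _ h => ?_) (fun g hg => ?_)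
  · rw [mem_filter] at hz ⊢
    refine ⟨mem_univ _, D.pow_mul_w_notMem _, ?_⟩
    rw [pow_mul_w_mul_self, ← pow_zero D.u, D.pow_eq_pow_iff, Nat.cast_mul, ZMod.natCast_zmod_val, Nat.cast_zero]
    exact hz.2
  · have e := (D.pow_mul_w_eq_iff _ _).mp h
    rwa [ZMod.natCast_zmod_val, ZMod.natCast_zmod_val] at e
  · obtain ⟨-, hgu, hgg⟩ := mem_filter.mp hg
    obtain ⟨i, -, rfl | rfl⟩ := D.exists_pow_or_pow_mul_w g
    · exact absurd (Subgroup.pow_mem _ (Subgroup.mem_zpowers _) i) hgu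
    · refine ⟨(i : ZMod (2 * n)), ?_, by rw [D.pow_val_natCast]⟩
      rw [mem_filter]
      refine ⟨mem_univ _, ?_⟩
      rw [pow_mul_w_mul_self, ← pow_zero D.u, D.pow_eq_pow_iff, Nat.cast_mul, Nat.cast_zero] at hgg
      exact hgg

include D in
/-- **THE BLOCK COUNT, arithmetic form**: `β · 4n = 4ⁿ + #{z ∈ ℤ/2n ∣ (r+1)·z = 0} · 2ⁿ` at 2-power level. [folklore] -/
theorem card_block_mul_four_mul_eq (hc2 : c * c = 1) (hc1 : c ≠ 1) {a : ℕ} (ha : n = 2 ^ a) :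
    Fintype.card (Block c) * (4 * n) =
      4 ^ n + (univ.filter fun z : ZMod (2 * n) => (((D.r + 1 : ℕ) : ZMod (2 * n)) * z = 0)).card * 2 ^ n := by
  rw [card_block_mul_four_mul D hc2 hc1 ha, card_coset_involutions D]

/-! ## §2 Rows: `SD₁₆`, `M₁₆`, `SD₃₂`, `M₃₂` -/

/-- **Row `SD₁₆`** (level `4`, `r + 1 ≡ 4 (mod 8)`, e.g. `r = 3`): `β = 20`. [folklore] -/
theorem card_block_eq_twenty (D : Datum G c 4) (hc2 : c * c = 1) (hc1 : c ≠ 1) (hr : ((D.r + 1 : ℕ) : ZMod (2 * 4)) = 4) :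
    Fintype.card (Block c) = 20 := by
  have h := card_block_mul_four_mul_eq D hc2 hc1 (a := 2) (by norm_num)
  have hc : (univ.filter fun z : ZMod (2 * 4) => (4 : ZMod (2 * 4)) * z = 0).card = 4 := by decide
  rw [hr, hc] at h
  omega

/-- **Row `M₁₆`** (level `4`, `r + 1 ≡ 6 (mod 8)`, i.e. `r = 5`): `β = 18`. [folklore] -/
theorem card_block_eq_eighteen (D : Datum G c 4) (hc2 : c * c = 1) (hc1 : c ≠ 1) (hr : ((D.r + 1 : ℕ) : ZMod (2 * 4)) = 6) :
    Fintype.card (Block c) = 18 := by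
  have h := card_block_mul_four_mul_eq D hc2 hc1 (a := 2) (by norm_num)
  have hc : (univ.filter fun z : ZMod (2 * 4) => (6 : ZMod (2 * 4)) * z = 0).card = 2 := by decide
  rw [hr, hc] at h
  omega

/-- **Row `SD₃₂`** (level `8`, `r + 1 ≡ 8 (mod 16)`, e.g. `r = 7`): `β = 2112`. [folklore] -/
theorem card_block_eq_2112 (D : Datum G c 8) (hc2 : c * c = 1) (hc1 : c ≠ 1) (hr : ((D.r + 1 : ℕ) : ZMod (2 * 8)) = 8) :
    Fintype.card (Block c) = 2112 := by
  have h := card_block_mul_four_mul_eq D hc2 hc1 (a := 3) (by norm_num)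
  have hc : (univ.filter fun z : ZMod (2 * 8) => (8 : ZMod (2 * 8)) * z = 0).card = 8 := by decide
  rw [hr, hc] at h
  omega

/-- **Row `M₃₂`** (level `8`, `r + 1 ≡ 10 (mod 16)`, i.e. `r = 9`): `β = 2064`. [folklore] -/
theorem card_block_eq_2064 (D : Datum G c 8) (hc2 : c * c = 1) (hc1 : c ≠ 1) (hr : ((D.r + 1 : ℕ) : ZMod (2 * 8)) = 10) :
    Fintype.card (Block c) = 2064 := by
  have h := card_block_mul_four_mul_eq D hc2 hc1 (a := 3) (by norm_num)
  have hc : (univ.filter fun z : ZMod (2 * 8) => (10 : ZMod (2 * 8)) * z = 0).card = 2 := by decide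
  rw [hr, hc] at h
  omega

end

end Summit.HodgeConjecture.CorCM.Census.IndexTwoCyclic
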